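import Summits.RiemannHypothesis.RiemannHypothesis.Theses.SpectralTrace
import Summits.RiemannHypothesis.RiemannHypothesis.Theorems.WindowTraceArch.Negative.UnitMass
import Literature.NumberTheory.LFunctions.WeilDilationVirialDeriv
import HarnessLib

/-!
# Sketch (crux-ideate round 2, ideator 5) — crux `WindowStep` (stmt-RiemannHypothesis-14659)
# Idea `christoffel-margin`: unit atoms certify a positivity margin (the Christoffel squeeze),
# and the step factorises as `UnitCertifiesMargin ∧ MarginRecrystallisation`.

Everything here is over existing declarations; `lean check` must be rc 0 with no `sorry`.

* `windowStep_of_margin` — the kernel-checked composition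
  `UnitCertifiesMargin → MarginRecrystallisation → WindowStep` (concludes the route decl BY NAME,
  consumes the rung hypothesis in BOTH stubs; neither stub alone is `WindowTraceArch → RH`:
  `UnitCertifiesMargin` + `WindowTraceArch` yields only `WeilPositivityOn (log 4 / 2)`,
  `unitCertifiesMargin_windowTraceArch`).
* `negativity_squeezes_atoms` — FIRST LEMMA of the line, PROVED here from landed pieces
  (`norm_sq_le_of_windowTrace` = unit room of the sibling dossier, Bombieri's dilation
  `weilDilate` and the integrated virial `re_weilQuadratic_weilDilate_eq_add_integral` of route
  WeilWindowFlow): every atom of every rung-`A` family pays, against every test `h` of the LARGER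
  half-window `(1+η)·A/2`, the inequality
  `‖(h_η)^(1/2+iγ_i)‖² ≤ Re Q(h) + ∫₀^η virial(h_s)/(1+s) ds`, `h_η = weilDilate η h`;
  so a negativity witness `Re Q(h) < 0` one collar up squeezes ALL atoms of ALL rung-`A`
  families into the set where the (contracted) transform of `h` is small — the mechanism of
  `UnitCertifiesMargin`.
* `weilChristoffel` — the Weil–Christoffel function (vocabulary; junk-safe `sInf` as
  `weilGroundEnergy`), antitone in the window by definition.
-/

noncomputable section

open Complex Set MeasureTheory

namespace Summit.RiemannHypothesis.RiemannHypothesis.Cruxes.WindowStep.Ideator5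

open Literature.NumberTheory.LFunctions
open Summit.RiemannHypothesis.RiemannHypothesis.Theses.SpectralTrace
open Summit.RiemannHypothesis.RiemannHypothesis.Theorems.WindowTraceArch.Negative

/-- `Trace(A)` (file-local notation, as in `Negative/Collapse.lean`). -/
local notation3 "WTrace " A:max => ∃ (ι : Type) (γ : ι → ℝ), ∀ g : ℝ → ℂ, IsWeilTest g →
  tsupport g ⊆ Set.Icc (-A) A →
    HasSum (fun i => weilMellin g (1 / 2 + (γ i : ℂ) * I)) (weilFunctional g)

/-! ## Vocabulary: the Weil–Christoffel function -/

/-- The Weil–Christoffel function at window `A` and height `t`: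
`λ_A(t) := inf { Re Q(h) : h Weil test, supp h ⊆ [-A/2, A/2], ĥ(1/2+it) = 1 }` — the maximal mass a
positive representing measure of `W` on the window `(-A, A)` can place at `t` (Akhiezer, Thm 2.5.2,
continual analogue; pick-slope's `Λ_L`). A unit atom at `t` needs `λ_A(t) ≥ 1`
(`norm_sq_le_of_windowTrace`). Antitone in `A` (infimum over a larger set). Junk value `0` when the
set is unbounded below (i.e. when positivity fails on the half window). -/
def weilChristoffel (A t : ℝ) : ℝ :=
  sInf {x : ℝ | ∃ h : ℝ → ℂ, IsWeilTest h ∧ tsupport h ⊆ Icc (-(A / 2)) (A / 2) ∧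
    weilMellin h (1 / 2 + (t : ℂ) * I) = 1 ∧ x = (weilQuadratic h).re}

/-! ## The two stubs of the line and the composition -/

/-- **U — unit atoms certify a positivity margin.** A real unit-multiplicity family reproducing `W`
on the rung window `[-log n, log n]` forces Weil positivity on the half window of rung `n + 2`,
`WeilPositivityOn (log (n+2) / 2)` — one full rung BEYOND what Bochner gives for free
(`windowTraceToPositivity`: `log n / 2`). RH-implied (its conclusion is); NOT `≥ (Arch → RH)`:
with `WindowTraceArch` it yields only `WeilPositivityOn (log 4 / 2)`. Mechanism: the Christoffel
squeeze `negativity_squeezes_atoms` + the CMS corridor of rung families. -/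
def UnitCertifiesMargin : Prop :=
  ∀ n : ℕ, 2 ≤ n → (WTrace (Real.log (n : ℝ))) →
    WeilPositivityOn (Real.log ((n : ℝ) + 2) / 2)

/-- **C′ — re-crystallisation under a positivity margin.** From a rung-`n` family AND Weil
positivity one rung beyond the target, a rung-`(n+1)` family. RH-implied; NOT `≥ (Arch → RH)`
(needs positivity inputs beyond `log 2 / 2`, unknown); this is the sibling crux `WindowTraceArch`'s
crystallisation problem at every level, with the positivity question REMOVED (given as input) and
the old family available as seed. By the card's toy/heuristic this is where RH lives
(integrality dies before positivity under ¬RH). -/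
def MarginRecrystallisation : Prop :=
  ∀ n : ℕ, 2 ≤ n → (WTrace (Real.log (n : ℝ))) →
    WeilPositivityOn (Real.log ((n : ℝ) + 2) / 2) → WTrace (Real.log ((n : ℝ) + 1))

/-- **Composition** (kernel-checked shape of the line): `U → C′ → WindowStep`, the rung hypothesis
consumed by both stubs, the conclusion the route decl by name. [folklore] -/
theorem windowStep_of_margin (hU : UnitCertifiesMargin) (hC : MarginRecrystallisation) :
    WindowStep := by
  intro n hn hT
  exact hC n hn hT (hU n hn hT)

/-- What `U` alone buys from the seed: `WindowTraceArch → WeilPositivityOn (log 4 / 2)` (i.e.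
positivity on `[-log 2, log 2]`, twice Yoshida's proved range `log 2 / 2`) — and nothing more
without re-crystallisation: the non-collapse check of the card. [folklore] -/
theorem unitCertifiesMargin_windowTraceArch (hU : UnitCertifiesMargin) (hArch : WindowTraceArch) :
    WeilPositivityOn (Real.log 4 / 2) := by
  have h := hU 2 le_rfl (by exact_mod_cast hArch)
  norm_num at h
  exact h

/-! ## First lemma (PROVED): the Christoffel squeeze across one collar -/

/-- **Negativity one collar up squeezes every atom of every rung family.** Let `γ` reproduce `W`
on the Weil tests supported in `[-A, A]`, let `η > 0`, and let `h` be ANY Weil test supported in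
the larger half window `[-(1+η)A/2, (1+η)A/2]`. Then Bombieri's dilate `h_η = weilDilate η h`
(`h_η(t) = (1+η)^{1/2} h((1+η)t)`) is a test of the half window `[-A/2, A/2]`, its transform at an
atom is `(1+η)^{-1/2} ĥ(1/2 + iγ_i/(1+η))` (`weilMellin_weilDilate`), and the unit atom at `γ_i`
pays (`norm_sq_le_of_windowTrace`)
`‖(h_η)^(1/2+iγ_i)‖² ≤ Re Q(h_η) = Re Q(h) + ∫₀^η weilDilationVirial (h_s)/(1+s) ds`
(`re_weilQuadratic_weilDilate_eq_add_integral`). If `Re Q(h) < 0` (positivity fails on the larger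
half window) the right side is `< ∫₀^η virial`, `O(η)`: ALL atoms of ALL rung-`A` families lie in
the sublevel set `{t : |ĥ(1/2 + it/(1+η))|² ≤ (1+η) ∫₀^η virial}` — the squeeze. [folklore] -/
theorem negativity_squeezes_atoms {A : ℝ} {ι : Type*} {γ : ι → ℝ}
    (hγ : ∀ g : ℝ → ℂ, IsWeilTest g → tsupport g ⊆ Icc (-A) A →
      HasSum (fun i => weilMellin g (1 / 2 + (γ i : ℂ) * I)) (weilFunctional g))
    {h : ℝ → ℂ} (hh : IsWeilTest h) {η : ℝ} (hη : 0 < η)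
    (hsupp : tsupport h ⊆ Icc (-((1 + η) * (A / 2))) ((1 + η) * (A / 2))) (i : ι) :
    ‖weilMellin (weilDilate η h) (1 / 2 + (γ i : ℂ) * I)‖ ^ 2 ≤
      (weilQuadratic h).re +
        ∫ s in (0 : ℝ)..η, weilDilationVirial (weilDilate s h) / (1 + s) := by
  have hη' : -1 < η := by linarith
  have hne : (1 + η) ≠ 0 := by linarith
  have hs := tsupport_weilDilate_subset h hη' hsupp
  rw [mul_div_cancel_left₀ _ hne] at hs
  have hle := norm_sq_le_of_windowTrace hγ (hh.weilDilate hη') hs i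
  rwa [re_weilQuadratic_weilDilate_eq_add_integral hh hη'] at hle

/-- The same, with the transform of the dilate rewritten at the CONTRACTED height
`γ_i/(1+η)`: `(h_η)^(1/2+iγ_i) = (1+η)^{1/2}(1+η)⁻¹ ĥ(1/2 + iγ_i/(1+η))`. [folklore] -/
theorem weilMellin_weilDilate_atom (h : ℝ → ℂ) {η : ℝ} (hη : 0 < η) (t : ℝ) :
    weilMellin (weilDilate η h) (1 / 2 + (t : ℂ) * I) =
      (Real.sqrt (1 + η) : ℂ) * ((1 + η : ℝ) : ℂ)⁻¹ *
        weilMellin h (1 / 2 + ((t : ℂ) * I) / ((1 + η : ℝ) : ℂ)) := by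
  rw [weilMellin_weilDilate h (by linarith : (-1 : ℝ) < η)]
  congr 2
  ring

end Summit.RiemannHypothesis.RiemannHypothesis.Cruxes.WindowStep.Ideator5

end
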